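import Literature.AlgebraicGeometry.Resolution.ProperModelsPatching
import Literature.AlgebraicGeometry.Resolution.ProperModelsPatchingGluing
import Literature.AlgebraicGeometry.Resolution.GraphClosureCompactification
import Literature.AlgebraicGeometry.Resolution.PrincipalizationToResolution
import Literature.AlgebraicGeometry.Resolution.ResolutionGlue
import Literature.AlgebraicGeometry.Resolution.QuasiExcellentSchemes
import Literature.AlgebraicGeometry.Morphisms.NagataCompactification
import HarnessLib

/-!
# Properness of the structure morphism is not load-bearing in the sandwiched-resolution statement

Topic: `Literature/AlgebraicGeometry/Resolution`. `SandwichedStrongResolution p`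
(`ProperModelsPatching.lean`; Cossart–Piltant 2019, Thm. 1.1 (i)–(ii) shape; OPEN in dimension
`≥ 4`) asks for a resolution which is an isomorphism over `Reg V` of every integral `V` PROPER and
birational over a regular integral separated `k`-scheme of finite type `U`. This file PROVES that
"proper" may be weakened to "separated and of finite type", modulo the named fact
`NagataCompactification` (Conrad 2007, Thm. 4.1 / Stacks 0F41) — hypothesis analysis of the atom of
the `sandwiched-gluing` line on crux stmt-ResolutionOfSingularities-0642 (cdisprove gen 5, (T6) of
`Cruxes/PatchingRel/Disproof.lean`): the sandwiched class is, up to taking opens, the class of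
integral varieties admitting a birational MORPHISM to a regular variety (e.g. every hypersurface
`f(x) t = g(x)` over `𝔸ⁿ` with `f, g` coprime, without passing through the blow-up `Bl_{(f,g)} 𝔸ⁿ`).

* `strongResolution_restrict` — a resolution which is an isomorphism over `Reg X` restricts, over
  every open `O ⊆ X`, to a resolution of `O` which is an isomorphism over `Reg O`.
* `strongResolution_of_iso` — transport along an isomorphism of the base.
* `sandwichedStrongResolution_of_not_proper` — for `η : V → U` separated, of finite type and
  birational (`V` integral, `U` regular integral separated of finite type over `k`,
  `char k = p`): Nagata-compactify `η` to `V ↪ V̄ → U`, replace `V̄` by the closure `Z` of `V`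
  (scheme-theoretic image, integral, `V ↪ Z` a dense open immersion,
  `exists_graphClosure_compactification`); `Z → U` is birational because over the iso-locus `U₀`
  of `η` the open immersion `η⁻¹(U₀) ≅ U₀ → Z_{U₀}` is proper, hence an isomorphism onto the
  irreducible `Z_{U₀}` (clopen lemma `SandwichedGluing.isIso_of_isOpenImmersion_of_isProper_comp`);
  apply `SandwichedStrongResolution p` to `Z → U` and restrict to the open `V`.

## References

* B. Conrad, *Deligne's notes on Nagata compactifications*, J. Ramanujan Math. Soc. 22 (2007),
  Thm. 4.1. [Conrad2007]
* V. Cossart, O. Piltant, J. Algebra 529 (2019), Thm. 1.1. [CossartPiltant2019]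
-/

noncomputable section

open CategoryTheory AlgebraicGeometry TopologicalSpace
open Literature.AlgebraicGeometry.Morphisms

namespace Literature.AlgebraicGeometry.Resolution

universe u

/-- Strong resolutions restrict to opens: if `π : Y → X` is a resolution which is an isomorphism
over an open `W` with `W = Reg X`, then for every open `O ⊆ X` the restriction `π⁻¹(O) → O` is a
resolution which is an isomorphism over `O ∩ W = Reg O` (open immersions induce isomorphisms on
local rings). [folklore] -/
theorem strongResolution_restrict {Y X : Scheme.{u}} {π : Y ⟶ X} (hπ : IsResolution π)
    {W : X.Opens} (hW : (W : Set X) = Scheme.regularLocus X) (hiso : IsIso (π ∣_ W))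
    (O : X.Opens) :
    ∃ (Y' : Scheme.{u}) (π' : Y' ⟶ (O : Scheme.{u})), IsResolution π' ∧
      ∃ W' : (O : Scheme.{u}).Opens, (W' : Set (O : Scheme.{u})) = Scheme.regularLocus (O : Scheme.{u}) ∧
        IsIso (π' ∣_ W') := by
  haveI := hπ.isProper
  refine ⟨_, π ∣_ O, ⟨inferInstance, hπ.isBirational.morphismRestrict O,
    hπ.isRegular.of_isOpenImmersion (π ⁻¹ᵁ O).ι⟩, O.ι ⁻¹ᵁ W, ?_, ?_⟩
  · ext x
    change O.ι x ∈ (W : Set X) ↔ x ∈ Scheme.regularLocus (O : Scheme.{u})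
    rw [hW, Scheme.mem_regularLocus, Scheme.mem_regularLocus, SandwichedGluing.mem_regularLocus_opens_iff]
    rfl
  · have hle : O.ι ''ᵁ (O.ι ⁻¹ᵁ W) ≤ W := by
      rw [Scheme.Hom.image_preimage_eq_opensRange_inf]; exact inf_le_right
    have h2 : IsIso (π ∣_ O.ι ''ᵁ (O.ι ⁻¹ᵁ W)) := isIso_morphismRestrict_of_le π hiso hle
    exact ((MorphismProperty.isomorphisms Scheme).arrow_mk_iso_iff
      (morphismRestrictRestrict π O (O.ι ⁻¹ᵁ W))).mpr h2

/-- Strong resolutions transport along isomorphisms of the base. [folklore] -/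
theorem strongResolution_of_iso {X X₁ : Scheme.{u}} (e : X ≅ X₁)
    (h : ∃ (Y : Scheme.{u}) (π : Y ⟶ X₁), IsResolution π ∧
      ∃ W : X₁.Opens, (W : Set X₁) = Scheme.regularLocus X₁ ∧ IsIso (π ∣_ W)) :
    ∃ (Y : Scheme.{u}) (π : Y ⟶ X), IsResolution π ∧
      ∃ W : X.Opens, (W : Set X) = Scheme.regularLocus X ∧ IsIso (π ∣_ W) := by
  obtain ⟨Y, π, hπ, W, hW, hiso⟩ := h
  haveI := hπ.isProper
  refine ⟨Y, π ≫ e.inv, ⟨inferInstance, hπ.isBirational.comp_iso e.inv, hπ.isRegular⟩,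
    e.hom ⁻¹ᵁ W, ?_, ?_⟩
  · ext x
    change e.hom x ∈ (W : Set X₁) ↔ x ∈ Scheme.regularLocus X
    rw [hW, Scheme.mem_regularLocus, Scheme.mem_regularLocus]
    exact ⟨fun h => IsRegularLocalRing.of_ringEquiv (asIso (e.hom.stalkMap x)).commRingCatIsoToRingEquiv,
      fun h => IsRegularLocalRing.of_ringEquiv (asIso (e.hom.stalkMap x)).commRingCatIsoToRingEquiv.symm⟩
  · rw [morphismRestrict_comp]
    have hWe : e.inv ⁻¹ᵁ (e.hom ⁻¹ᵁ W) = W := by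
      rw [← Scheme.Hom.comp_preimage, e.inv_hom_id, Scheme.Hom.id_preimage]
    have h1 : IsIso (π ∣_ e.inv ⁻¹ᵁ (e.hom ⁻¹ᵁ W)) :=
      ((MorphismProperty.isomorphisms Scheme).arrow_mk_iso_iff (morphismRestrictEq π hWe)).mpr hiso
    refine @IsIso.comp_isIso _ _ _ _ _ _ _ h1 ?_
    infer_instance

/-- **`IsProper η` is not load-bearing in `SandwichedStrongResolution`** (modulo Nagata): an
integral `V` with a SEPARATED, FINITE TYPE, birational morphism `η : V → U` to a regular integral
separated `k`-scheme of finite type is an open of a sandwiched scheme (Nagata-compactify `η`,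
take the closure of `V`; birationality of the closure over `U` by the clopen lemma), so it has a
resolution which is an isomorphism over `Reg V`. [cite: Conrad2007, Thm. 4.1 (use of Nagata compactification)] -/
theorem sandwichedStrongResolution_of_not_proper {p : ℕ} (hS : SandwichedStrongResolution.{u} p)
    (hN : NagataCompactification.{u}) (k : Type u) [Field k] [CharP k p] (U V : Scheme.{u})
    (f : U ⟶ Spec (.of k)) (η : V ⟶ U) [IsSeparated f] [LocallyOfFiniteType f] [QuasiCompact f]
    [IsIntegral U] (hU : Scheme.IsRegular U) [IsIntegral V] [IsSeparated η]
    [LocallyOfFiniteType η] [QuasiCompact η] (hη : IsBirational η) :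
    ∃ (Y : Scheme.{u}) (π : Y ⟶ V), IsResolution π ∧
      ∃ W : V.Opens, (W : Set V) = Scheme.regularLocus V ∧ IsIso (π ∣_ W) := by
  haveI : CompactSpace U := QuasiCompact.compactSpace_of_compactSpace f
  haveI : U.IsSeparated := Scheme.isSeparated_of_isSeparated_over f
  -- Nagata compactification of `η`
  obtain ⟨Vc, j, gc, hj, hgc, hfac⟩ := hN V U η
  haveI := hj
  haveI := hgc
  -- closure of `V` in the compactification
  haveI : IsNoetherian U := Scheme.isNoetherian_of_finiteType_over_field f
  haveI : IsLocallyNoetherian Vc := LocallyOfFiniteType.isLocallyNoetherian gc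
  obtain ⟨Z, c, s, hZ, hc, hsc, hs, hdense, -⟩ :=
    exists_graphClosure_compactification j (𝟙 Vc) j (Category.comp_id j)
  haveI := hZ
  haveI := hc
  haveI := hs
  -- `ζ : Z → U` is proper and extends `η`
  have hη : η = s ≫ c ≫ gc := by rw [← Category.assoc, hsc, hfac]
  subst hη
  haveI : IsProper (c ≫ gc) := inferInstance
  generalize c ≫ gc = ζ at *
  -- birationality of `ζ`: over the iso-locus `U₀` of `η`, `s` is a proper open immersion into the
  -- irreducible `ζ⁻¹(U₀)`, hence an isomorphism
  have hbir : IsBirational ζ := by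
    obtain ⟨U₀, hU₀, hpre, hiso⟩ := hη
    have hne : ((s ≫ ζ) ⁻¹ᵁ U₀ : Set V).Nonempty := by
      haveI : Nonempty V := inferInstance
      exact hpre.nonempty
    obtain ⟨v, hv⟩ := hne
    have hζne : (ζ ⁻¹ᵁ U₀ : Set Z).Nonempty := ⟨s v, hv⟩
    haveI : Nonempty (ζ ⁻¹ᵁ U₀ : Scheme.{u}) := ⟨⟨s v, hv⟩⟩
    haveI : IsIntegral (ζ ⁻¹ᵁ U₀ : Scheme.{u}) := isIntegral_of_isOpenImmersion (ζ ⁻¹ᵁ U₀).ι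
    haveI : Nonempty ((s ≫ ζ) ⁻¹ᵁ U₀ : Scheme.{u}) := ⟨⟨v, hv⟩⟩
    -- the restriction of `s` over `ζ⁻¹(U₀)`
    let i : ((s ≫ ζ) ⁻¹ᵁ U₀ : Scheme.{u}) ⟶ (ζ ⁻¹ᵁ U₀ : Scheme.{u}) :=
      (Scheme.isoOfEq V (Scheme.Hom.comp_preimage s ζ U₀)).hom ≫ s ∣_ (ζ ⁻¹ᵁ U₀)
    haveI : IsOpenImmersion i := inferInstance
    have hi : i ≫ ζ ∣_ U₀ = (s ≫ ζ) ∣_ U₀ := by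
      rw [← cancel_mono U₀.ι]
      simp only [i, Category.assoc, morphismRestrict_ι]
      rw [morphismRestrict_ι_assoc, Scheme.isoOfEq_hom_ι_assoc]
    haveI : IsIso ((s ≫ ζ) ∣_ U₀) := hiso
    haveI : IsProper (i ≫ ζ ∣_ U₀) := by rw [hi]; infer_instance
    haveI : IsIso i := SandwichedGluing.isIso_of_isOpenImmersion_of_isProper_comp i (ζ ∣_ U₀)
    have hζiso : IsIso (ζ ∣_ U₀) := by
      have : ζ ∣_ U₀ = inv i ≫ (s ≫ ζ) ∣_ U₀ := by rw [← hi, IsIso.inv_hom_id_assoc]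
      rw [this]; infer_instance
    exact ⟨U₀, hU₀, (ζ ⁻¹ᵁ U₀).2.dense hζne, hζiso⟩
  -- strong resolution of the sandwiched `Z`, restricted to the open `V ≅ s.opensRange`
  obtain ⟨Y, πZ, hres, WZ, hWZ, hisoZ⟩ := hS k U Z f ζ inferInstance inferInstance inferInstance
    inferInstance hU inferInstance inferInstance hbir
  exact strongResolution_of_iso s.isoOpensRange (strongResolution_restrict hres hWZ hisoZ s.opensRange)

end Literature.AlgebraicGeometry.Resolution

end
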